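import Literature.MathematicalPhysics.QuantumFieldTheory.Balaban1983to89.B12
import Literature.MathematicalPhysics.QuantumFieldTheory.Balaban1983to89.B12Eq019ActionBody
import Literature.MathematicalPhysics.QuantumFieldTheory.Balaban1983to89.B12Form13Step268
import Literature.MathematicalPhysics.QuantumFieldTheory.Balaban1983to89.BlockAveragingTwoLevel
import Literature.MathematicalPhysics.QuantumFieldTheory.Balaban1983to89.B12RT013TwoLevel

/-!
# `Balaban1983to89.B12Carve17Sect0ModelHyp` — [B12] pp. 249–256 (Sect. 0, part 1: the model, the actions, the averaging
# operations (0.4)–(0.12), the renormalization transformations (0.13)–(0.20), the background fields (0.21) and the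
# representation (0.22)–(0.23)) CARVED: the section's printed defining relations conjoined BY NAME into one hypothesis
# bundle over the cell vocabulary `Setup` — `HypK` (§5, v1.1, the bundle of record: renormalization transformations bound
# on print's range `k < K`; `Hyp` of §3 is its all-level predecessor, kept) —, keyed to `stmt-QuantumFields-20541` (also
# feeds `stmt-QuantumFields-20543`);
# the two printed side conditions of pp. 251–254 that no declaration of the tree states over these carriers, typed
# hypothesis-form (`ParamsPrinted`, `AveragingPrinted`); the p. 255 remark on the two differential forms of the
# renormalization group equation, PROVED; and the in-tree citation index of the block's twenty-nine SKELETON rows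

statement-level skeleton of published theorems with citation tags; proofs where landed; nothing here is a claim about the
Yang–Mills mass gap

CITATION HEADER (lean-in-tree rule).  B12 = T. Bałaban, *Renormalization group approach to lattice gauge field theories.
I. Generation of effective actions in a small field approximation and a coupling constant renormalization in four
dimensions*, Commun. Math. Phys. **109** (1987) 249–301 [Balaban1987RG1] (doi:10.1007/bf01215223; held
`paper:balaban1987-cmp109-rg-i-small-field`, journal page = PDF page + 248; text layer `pNNNN.txt` of `lit read`; the page
renders `pub/pub-balaban/b2b-balaban-ref1/pages/1987-cmp109-rg-I-small-field/…-p003-x2.png … -p008-x2.png` of pp. 251–256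
were READ AS IMAGES by this seat, 2026-08-28; pp. 249–250 [PDF 1–2] are the historical introduction and carry no
mathematical statement).  Print's references used on these pages: [12] = B7 = T. Bałaban, *Averaging operations for lattice
gauge theories*, Commun. Math. Phys. **98** (1985) 17–51 [Balaban1985Averaging]; [15] = B11 = T. Bałaban, *The variational
problem and background fields in renormalization group method for lattice gauge theories*, Commun. Math. Phys. **102** (1985)
277–309 [Balaban1985Variational]; [16] = B10 = *Ultraviolet stability of three-dimensional lattice pure gauge field
theories*, Commun. Math. Phys. **102** (1985) 255–275 [Balaban1985UV3]; [35 (II)] = P. Federbush, *A phase cell approach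
to Yang–Mills theory* [Federbush1987PhaseCellVI] (the tree's `Federbush1986/`); [71] = V. S. Varadarajan, *Lie groups, Lie
algebras and their representations* [Varadarajan1984].  Cell `lit-balaban`, P6 CARVING FAN (D-0154 (3b)), BLOCK 17 of
`carve/BLOCKS-11-20.md` (lead g30, 2026-08-28T05:30Z): source section = [B12] Sect. 0 «Introduction. Formulations of
Results», first part, journal pp. 249–256 [PDF 1–8], displays (0.1)–(0.23); KEY item `stmt-QuantumFields-20541` (K0⁷
`Record13SepCoPHInhabited`, lane N07 [B11]∕[B12]§0∕[B14]∕[B15]); also feeds `stmt-QuantumFields-20543`.  Seat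
`lit-balaban-carve-17` (literature-prover-lit-balaban-carve-17-g0-0).  Rules `carve/CARVE-RULES.md`: in tree = cite,
never restate; hypothesis form; no `instance`, no `notation`; 0 sorry; desk stems (`Node00/*`, `T3*`, `T4*` node files,
`B11Thm1*`, `B11Leaf*`, and the decade-1 list) untouched — cited where relevant, not carved into.

WHAT THIS FILE IS.  The block is IN TREE at statement level (29 SKELETON rows of v3.368: 14 proved, 9 proved-existing, 6
typed-existing; `carve/CARVE-LIST.md` v5 Block 17 counts 0 residual display labels) — and far beyond: the cell vocabulary
`Setup` IS [B12] §0 typed symbol by symbol, and the displays (0.4)–(0.23) have declarations WITH BODY and, for every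
asserting sentence of pp. 251–256 but one, PROVED theorems (INDEX below).  Accordingly this file (i) RESTATES NOTHING that
has a declaration: every row and every asserting sentence is cited by name in the INDEX, and the section's
HYPOTHESIS-FORM declarations are USED, by name, in the bundle `Hyp` (a definition with body or a proved theorem is cited
only — it is not a hypothesis); (ii) types, hypothesis-form over the carriers of `Setup` (`Params`, `GaugeGroup`,
`GroupAverage`, `LoopAverage`, `Averaging`, `ContourData`, `RTOpI`, `EffActionSeq`, `Background`), the two printed side
conditions of the section that no declaration states over these carriers — `ParamsPrinted` (p. 251 «L is an odd,
positive integer > 11, and m is a positive integer», p. 252 «we … write all formulas below for this case [d = 4]»;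
`Setup.Params` carries only `Odd L ∧ 1 < L`, DIVERGENCE F1, and leaves `m`, `d` free; the family carrier
`T4Continuum.T4Family` of the KEY consumer carries the printed clauses as FIELDS, and §4 delivers `ParamsPrinted` there) and
`AveragingPrinted` (pp. 252–254: the renormalization transformations average by (0.4), or by (0.12) built on the averaged
contour variables (0.11) — «both definitions are equally good for our purposes» p. 254 — pinned to the tree's
constructions WITH BODY `BlockAveraging.blockAvg`, `BlockAveragingTwoLevel.blockAvg₂`, `BlockAveragingTwoLevel.contourData`;
the SU(N)-data version with print's literal exp-mean-log ∕ Federbush prescriptions is the tree's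
`T4Continuum.FiniteEpsData.IsPrintedAveraged`, cited, a different carrier); (iii) PROVES the one asserting sentence of the
section found without a declaration — p. 255, after (0.18): «the differential equation (d∕ds)(1∕g²) = −β(g), or (dg∕ds) =
½β(g)g³» (the equivalence of the two forms, `hasDerivAt_invSq_iff`) together with its finite-difference reading of (0.18)
(`diff018_of_satisfiesRG`); (iv) defines ONE bundle `Hyp` = the conjunction, by name, of the section's printed defining
relations — parameters, averaging prescription, the small-field steps (0.17)∕(0.19) with «N_k is given by the integral
above with V = 1» (`Setup.SmallFieldStepI`), the start `A_0 = −(1∕g₀²)A` of (0.17) (`B12Eq019ActionBody.wilsonTerm`), the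
recursive renormalization group equations (0.18)∕(0.20) (`Setup.Flow.SatisfiesRG`), the background fields (0.21)
(`Setup.Background`, whose field `isBackground` is `Setup.IsBackground`), the representation (0.22)
(`Setup.EffActionSeq.Representation`) and the sum (0.23) (`B12.Sum023Printed`); (v) records (§4, kernel-checked
bookkeeping over the bundle; nothing printed is proved there) how the bundle delivers the section's derived sentences
through the tree's own theorems: «defined inductively» (`Hyp.effAction_eq_printedSeq` by
`B12Eq019ActionBody.eq_actionSeq_of_steps`), the telescoped (0.20) (`Hyp.invSq_telescope` by `Step.inv_sq_telescope`),
«𝐄_k … is equal to (1∕g_k²)A + A_k» (`Hyp.Ek_eq` by `B12Eq019ActionBody.Ek_eq_of_representation`), and the discharge of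
the (0.23) conjunct by the tower body `Step.SFTower.Ek` (`sum023_of_tower` by `B12Form13Step268.sum023Printed_Ek`).  It
moves no node count and proves no summit statement.

v1.1 (2026-08-28, seat literature-prover-lit-balaban-carve-17-g14-0; APPEND-ONLY over p612091 — `ParamsPrinted`,
`AveragingPrinted`, §2, `Hyp`, `hyp_iff` and every §4 theorem are byte-identical).  check-2 g4 SECOND-READ RULING M-c2-1
(`carve/CHECK-2.md` § Verdicts 2026-08-28T10:42:11Z; binder range ∕ instantiability — no printed clause mis-transcribed):
`Hyp` binds the renormalization transformations `T : ∀ k, RTOpI P k G (av k)` at EVERY level `k : ℕ` while conjunct (2)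
pins `av k` to (0.4) ∕ (0.12) at every `k`, whereas print has T^{(k)} for `k = 0, …, K − 1` only (p. 256 «the sequence of
actions and coupling constants is defined for k = 0,1,...,K»); since an `RTOpI` over an averaging exists only under Haar
absolute continuity of its map, proved in the tree for (0.4) ∕ (0.12) in the standing range `k + 1 ≤ m + K` only, the pair
(binder `T`, conjunct (2)) of `Hyp` has no constructible instance at print's groups.  §5 adds THE BUNDLE OF RECORD `HypK` —
the same seven conjuncts with `T : ∀ k, k < P.K → RTOpI P k G (av k)` and (3) reading `∀ k (hk : k < P.K), SmallFieldStepI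
(T k hk) …` — with `hypK_iff`, `hypK_of_hyp` (v1 ⇒ v1.1), the §4 bookkeeping restated over `HypK` (the total operator
family `opOfRange T` feeding `B12Eq019ActionBody.printedSeq`), and the kernel-checked instantiation of the repaired pair at
`SU(N)`, every `N ≥ 1`, by print's own transformation `B12RT013TwoLevel.rtOpITwoLevelFederbush`
(`averagingPrinted_and_binder_federbush`).  KEY consumers take `(h : HypK …)`.

INDEX — the twenty-nine SKELETON rows of block 17 (row id · printed item · page: journal [PDF] · IN-TREE declarations cited
BY NAME, all under `Literature.MathematicalPhysics.QuantumFieldTheory.Balaban1983to89.`; «used» = conjoined in `Hyp`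
below; «body» ∕ «proved» = a definition with body ∕ a theorem in the tree, hence not a hypothesis here):
* B12.Eq0.1 · (0.1) `T_ε = {x ∈ εZ^d + Σ ½εe_μ : −L_μ < x_μ < L_μ}`, `ε = L^{−K}`, the tori `T^{(k)}_{L^kε}`, `Δ(y)` · p. 251
  [3] · `Params`, `Params.eps`, `Params.sitesPerDir`, `Site`, `blockOf`, `emb`, `block` (body, `Setup`); `Params.spacing`
  (body, `TorusGeometry`); the side conditions «L odd > 11», «m positive», «d = 4»: `T4Continuum.T4Family.hL11` ∕ `.hm`,
  `Missing.params4` (fields ∕ body on the family carrier) and `ParamsPrinted` (§1 here, used).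
* (the sentences «We assume that G is semisimple and that it is a Lie subgroup of a group of complex unitary matrices, for
  example G ⊂ U(N)», «Elements of this group [Gᶜ] are defined as matrices of the form 𝐔 = U′U, where U ∈ G and U′ = exp iA′,
  A′ ∈ 𝐠ᶜ, 𝐠ᶜ is the complexification of the real Lie algebra 𝐠») · pp. 251–252 [3–4] · the interface `GaugeGroup` (`Setup`,
  DIVERGENCE F4); `B12LieComplexification.isSemisimple_complexify_of_le_unitaryLie` ∕ `isSemisimple_complexify_su` (proved,
  [71] Cor. 3.9.4); `B12ComplexifiedGroup.exists_lieSubalgebra_polar` ∕ `existsUnique_polar` ∕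
  `mem_complexifiedGroup_iff_exists_lieC` (proved).
* B12.Eq0.2, B12.Eq0.2-5 · (0.2) `A^ε(U) = Σ_p ε^{d−4}[1 − Re tr U(∂p)]`, «tr 1 = 1», `U(∂p) = (∂U)(p)` · p. 252 [4] ·
  `wilsonAction`, `wilsonAction4`, `GaugeField.plaqHol`, `GaugeGroup.reTr_one` (body); `B12Form13Step268.wilsonAction_one`
  (proved); the normalisation dictionary `B12Normalization` (body).
* B12.Eq0.3, B12.Def@252 · (0.3) `B^k(y) = Δ(y) ∩ T^{(n−k)}`, the contour families `𝐆(y, x)` by permutations of the axes,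
  `[x, x′]` · p. 252 [4] · `blockOf`∕`block` (body); `T4Continuum.stairWord`, `BlockAveraging.loopHol`,
  `BlockAveragingTwoLevel.stairHol` ∕ `seg` (body); `B12ContourAverage253.permWord` (body); the multiplicity sentence
  `B12ContourMultiplicity252` (proved).
* B12.Eq0.4 · (0.4) `Ū(c) = M(U, c) = exp[i Σ_{x∈B(c₋)} L^{−d} Σ_Γ |𝐆|⁻¹ Σ_{Γ′} |𝐆|⁻¹ (1∕i) log U(Γ∪[x,x′]∪(−Γ′)∪(−c))] U(c)`
  · p. 253 [5] · `BlockAveraging.blockAvg ℰ` with `BlockAveraging.corr` ∕ `avgFun` (body, general `G`, outer operation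
  axiomatised as `LoopAverage`), `ExpMeanLog.eml`, `ExpMeanLog.expMeanLogU` ∕ `expMeanLogSU` (body, the literal
  exp-mean-log on U(N) ∕ SU(N)), `T4Continuum.FiniteEpsData.IsPrintedAveraged₁` (SU(N) data); `AveragingPrinted` (§1, used).
* B12.Eq0.5-0.7, B12.Eq0.5-0.9 · (0.5) `M({U_j⁻¹}) = M({U_j})⁻¹`, (0.6) `M({uU_jv}) = uM({U_j})v`, (0.7) permutation
  invariance, on «sets {U_j} … with sufficiently small diameters» · p. 253 [5] · `GroupAverage` (fields `inv`,
  `equivariant`, `perm` on `FamilySmall δ`), `LoopAverage`, `GroupAverage.avg` ∕ `Adm` (body); the no-total-average lemma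
  `LoopAverage.no_total_symmetric_equivariant_pair_average` (proved).
* B12.Eq0.8 · (0.8) `(1∕i) log M({exp iA_j}) = (1∕n) Σ A_j + (higher order terms)`, «we assume that it is an analytic
  function» · p. 253 [5] · hypothesis structure `B7TransferAnalyticMean.IsAnalyticMean` (abstract Banach-algebra tuples;
  NOT expressible over the bare interface `GaugeGroup`, which has no logarithm — HONEST SCOPE (b)); for Federbush's mean:
  `B12Average05And08.norm_mlog_fedAvg_sub_mean_le` (proved, constant 500).
* B12.Eq0.9 · (0.9) «if U_j ∈ G, then M({U_j}) ∈ G also» · p. 253 [5] · built into the type of `GroupAverage.M`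
  (`G`-valued; `Gᶜ` is not modelled, DIVERGENCE F4); for Federbush's mean `B12Average012Prop2.fedSol_mem_unitary`,
  `B12Average012Prop2.avgBar_mem_unitaryUnits`, `B12Average09SpecialUnitary` (proved).
* B12.Eq0.10 · (0.10) `Σ_j (1∕i) log U_jU⁻¹ = 0` and «This definition has all the properties listed above, as it was proved by
  Federbush in [35 (II)]» · p. 253 [5] · `FederbushMean.IsPureAverage`, `FederbushMean.isPureAverage_iff_eq010`,
  `FederbushMean.existsUnique_isPureAverage_eq_federbushU` ∕ `…SU` (proved); the five properties for this mean PROVED: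
  (0.5) `B12Average05And08.fedAvg_inv_family`, (0.6) `B12ContourAverage253.fedAvg_mul_mul`, (0.7)
  `B12ContourAverage253.fedAvg_comp_equiv` ∕ `fedAvg_base_indep`, (0.8) `B12Average05And08.norm_mlog_fedAvg_sub_mean_le`,
  (0.9) `B12Average012Prop2.fedSol_mem_unitary`; analyticity `B12Average012Analytic`, `B15AveragingHolomorphic` (proved).
* B12.Eq0.11 · (0.11) `U(y, x) = M({U(Γ)}_{Γ∈𝐆(y,x)})` · p. 253 [5] · `ContourData` (the abstraction, `Setup`),
  `BlockAveragingTwoLevel.contourData 𝓜` ∕ `holTo` ∕ `cVar` (body, used through `AveragingPrinted`),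
  `B12ContourAverage253.Tavg` (body, `ℤᵈ` lineage); `Averaging.iter` (body) for `M^k`.
* B12.Eq0.12 · (0.12) `Ū(c) = exp[i Σ_{x∈B(c₋)} L^{−d}(1∕i) log U(c₋,x)U([x,x′])U(x′,c₊)U(−c)] U(c)` and «all results of the
  paper [12] are valid for it» · p. 254 [6] · `BlockAveragingTwoLevel.blockAvg₂ 𝓜 ℰ` ∕ `loopHol₂` ∕ `corr₂` (body, used
  through `AveragingPrinted`), `T4Continuum.FiniteEpsData.IsPrintedAveraged₂` ∕ `IsPrintedAveraged` (SU(N) data),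
  `B12AverageCorridor267.avgM` (`ℤᵈ` lineage); [12]'s results for (0.12) PROVED one by one:
  `B12Average012Prop1.prop1Printed_avgBar` (Prop. 1), `B12Average012Prop2.prop2Printed_avgBar` (Prop. 2),
  `B12Average012Covariance` ((11) of [12]), `B12Average012Locality`, `B12Average012Permutation`, `B12Average012Analytic` ∕
  `B12Average012AnalyticIter`, `B12QtildeRemainder123` — the blanket sentence for the remaining propositions of [12] has no
  single declaration (HONEST SCOPE (c)).
* B12.Eq0.13, B12.Eq0.13-0.16 · (0.13) `(Tρ)(V) = ∫dU t(V,U)ρ(U)`, «If ρ is a gauge invariant function, then Tρ is gauge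
  invariant also», «still invariant with respect to the gauge transformations u satisfying u(y) = 1 for y ∈ T⁽¹⁾» · p. 254
  [6] · `B12FaddeevPopov016.KernelRT` ∕ `KernelRT.T` ∕ `FineGauge` ∕ `KernelRT.FineInvariant` (body); `RTOp`, `RTOpI`,
  `IsRT` (`Setup`, the push-forward form of the δ-kernel `δ(ŪV⁻¹)`; `RTOpI` is the carrier of `Hyp`);
  `B12RTGaugeInvariance254.kernelRT_gaugeInvariant`, `rtOpI_gaugeInvariant_ae`, `integrand_fineInvariant` (proved); print's
  own `T` over (0.12): `B12RT013TwoLevel.rtOpITwoLevel` ∕ `rtOpITwoLevelStd` ∕ `nonempty_rtOpI_family_federbush` (body).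
* (the sentence «restricted to regular configurations U, i.e. … |U(∂p) − 1| < ε₀») · p. 254 [6] · `PlaqSmall`, `chiSmall`
  (body, `Setup`; rows B12.Eq1.2-7 of block 19).
* B12.Eq0.14, B12.Eq0.14-0.17 · (0.14) `exp[−(1∕2α)|U(y,x) − 1|²] = exp[−(1∕α)[1 − Re tr U(y,x)]]` · p. 254 [6] ·
  `MatrixNorms.nhsNormSq_sub_one_of_mem_unitaryGroup` (proved); `expGaugeFixWeight`, `gaugeFixFn` (body, `Setup`).
* B12.Eq0.15 · (0.15) `(1∕z)∫du(x) exp[−(1∕α)[1 − Re tr U(y,x)u⁻¹(x)]]χ(…) = (1∕z)∫du(x) exp[−(1∕α)[1 − Re tr u(x)]]χ(…) = 1`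
  · pp. 254–255 [6–7] · `B12FaddeevPopov016.fp015`, `fp015_normalised` (proved); `z` = `B16ZLower.zNorm` (body).
* B12.Eq0.16 · (0.16) and the Faddeev–Popov sentence «the integrand does not depend on u and the integral over u is equal
  to 1. Thus we get (0.16)» · p. 255 [7] · `B12FaddeevPopov016.FP016` (hypothesis-form) with
  `B12FaddeevPopov016.fp016_of_fineInvariant` (PROVED under the printed invariance hypotheses), `fpWeight` (body).
* (the sentence «fix a configuration U₀ in this region, then configurations U from this region satisfy |U − U₀| < O(1)ε₀ on
  T, with an absolute constant O(1)») · p. 255 [7] · `B12SmallFieldRegion255.norm_sub_le_of_mem_smallFieldRegion` (proved,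
  `O(1) = 128(dL)³`).
* B12.Eq0.17 · (0.17) `A₁(V) = (𝐓₀A)(V) = log 𝐍₀⁻¹ ∫dU Π_c δ(Ū(c)V⁻¹(c)) χ₀ exp[−(1∕g₀²) Σ_y Σ_{x∈B(y),x≠y}[1 − Re tr U(y,x)] −
  (1∕g₀²)A(U)]`, «𝐍₀ is given by the same integral as above, but with V = 1» · p. 255 [7] · `SmallFieldStep` ∕
  `SmallFieldStepOp` ∕ `SmallFieldStepI` and `gaugeFixFn` (`Setup`, used), `B12Eq019ActionBody.firstAction` ∕ `wilsonTerm`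
  ∕ `nextAction` ∕ `normConst` ∕ `nextAction_one` (body ∕ proved; `wilsonTerm` used), `B12RT013TwoLevel.gf017` (body).
* (the sentence «The action A₁ determines a function β₁(g₀) of the bare coupling constant g₀, defined on an interval [0, γ],
  γ > 0 … Now we assume the existence of the first function») · p. 255 [7] · the binder `Flow.β` (`Setup`),
  `Step.SFHyp.betaSmooth` (on `Set.Icc 0 γ`), the definition (1.20)–(1.22) `B12Beta.Kernel`, `B12BetaAsPrinted.Definitions`
  (rows of block 19); an assumption, entering `Hyp` as the datum `S.flow.β`.
* B12.Eq0.18, B12.Eq0.18-0.20 · (0.18) `1∕g₀² = 1∕g₁² + β₁(g₀)`, (0.20) `1∕g_k² = 1∕g²_{k+1} + β_{k+1}(g_k)` · pp. 255–256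
  [7–8] · `Flow.SatisfiesRG` (`Setup`, used), `Step.RGEq` with `Step.rgEq_iff` (`Iff.rfl`), `Step.inv_sq_telescope`
  (proved), `B12BetaAsPrinted.RunHyp` (field `rg`), `FlowStep.RGEqH` (history-indexed); the remark «finite difference
  approximation … of (d∕ds)(1∕g²) = −β(g), or (dg∕ds) = ½β(g)g³» — §2 here, `diff018_of_satisfiesRG` and
  `hasDerivAt_invSq_iff` (PROVED; before this file quoted only, in the docstrings of `T4OneLoopAsymptotics` ∕ `T4TwoLoopLaw`).
* B12.Eq0.19 · (0.19) `A_{k+1}(g_{k+1}, V) = (𝐓_kA_k)(g_{k+1}, V) = log 𝐍_k⁻¹ ∫dU Π_c δ(Ū(c)V⁻¹(c)) χ_k exp[−(1∕g_k²) Σ Σ [1 − Re tr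
  U(y,x)] + A_k(g_k, U)]`, «𝐍_k is given by the integral above with V = 1», «the sequence of actions and coupling constants is
  defined for k = 0, 1, …, K» · pp. 255–256 [7–8] · `SmallFieldStepI` (used), `B12Eq019ActionBody.actionSeq` ∕ `printedSeq`
  ∕ `eq_actionSeq_of_steps` ∕ `smallFieldStepOp_iff` (body ∕ proved; §4 `Hyp.effAction_eq_printedSeq`); «χ_k restricts the
  integral to small fluctuation fields»: `B12SmallFieldDomain259.chiFluct` (row B12.Eq2.9, block 20) — in `Hyp` the
  characteristic functions are the abstract data `χ`.
* B12.Eq0.20 · (0.20) · p. 256 [8] · `Flow.SatisfiesRG` (used); `Flow` docstring (the Markov reading «β_{k+1}(g_k)»).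
* B12.Eq0.21, B12.Eq0.21-6 · (0.21) `U ↦ A^η(U)` on `{U : Ū^k = M^k(U) = V}`, «These transformations form a group, and the
  functional (0.21) can be considered on orbits of this group», «In [15] it was proved that in a space of regular orbits
  there exists exactly one critical orbit, which is a set of minima of the function (0.21)» · p. 256 [8] · `IsBackground`,
  `Background` (used), `Averaging.iter` (`Setup`); `B12GaugeOrbits021.IsResidual` ∕ `residualGroup` ∕ `surface` ∕ `OrbitRel` ∕
  `functional021OnOrbits` ∕ `isBackground_iff_of_orbitRel` ∕ `exprs21_invariant` (body ∕ proved); [15] Theorem 1 =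
  `B11.Thm1Printed` (row B11.Thm1, BLOCK 11, conjoined there) with `B11Thm1.thm1At_allLevels` (cited, not touched).
* B12.Eq0.22, B12.Eq0.22-0.25 · (0.22) `A_k(g_k, V) = A_k(g_k, U_k(V)) = −(1∕g_k²)A^η(U_k(V)) + 𝐄_k(U_k(V))`, «the effective
  action A_k depends on V through these fields» · p. 256 [8] · `EffActionSeq` ∕ `EffActionSeq.Representation` (`Setup`, used),
  `B12.Repr022` (the family-level twin over `B12.RunData`), `Step.SFTower.action16_eq` (body),
  `B12Eq019ActionBody.Ek_eq_of_representation` ∕ `action21` (proved ∕ body; §4 `Hyp.Ek_eq`).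
* B12.Eq0.23 · (0.23) `𝐄_k(U_k) = Σ_{j=1}^{k}[−β_j(g_{j−1})A^η(U_k) + 𝐄^{(j)}(U_k)]`, «The function 𝐄_k depends also on the
  effective coupling constants g₀, …, g_{k−1}», «In the first step … The expression in the square bracket is equal to 𝐄₁. In
  the second step a new expression of this type is created» · p. 256 [8] · `B12.Sum023Printed` (used), `Step.SFTower.Ek`
  (body), `B12Form13Step268.Ek_at_one` ∕ `action16_one_step` ∕ `Ek_succ` ∕ `action16_succ` ∕ `sum023Printed_Ek` (proved; §4
  `sum023_of_tower`).
The further STATEMENT-LEVEL declarations whose locator falls in pp. 249–256 (`carve/CARVE-LIST.md` v5, Block 17: six) are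
CITED for the stated reasons: `B12.Sum023Printed` (used); `B12BetaAsPrinted.RunHyp` (Theorem 3's run hypothesis, p. 264 with
(0.20) — block 19; its `rg` field is the history-indexed form of the conjunct `Hyp.rg020`); `B12BetaAsPrinted` (the whole
β-function record, blocks 19 and 25–26); `T4Continuum.FiniteEpsData.IsPrintedAveraged₁` ∕ `IsPrintedAveraged₂` ∕ `IsPrintedAveraged`
(the SU(N)-data pins of (0.4) ∕ (0.12), print's literal prescriptions; `AveragingPrinted` is the general-`G` pin over
`Setup.Averaging` ∕ `ContourData` with the axiomatised averages — a different carrier, cross-referenced, not restated).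

HONEST SCOPE.  (a) `ParamsPrinted` and `AveragingPrinted` are SIDE CONDITIONS of print's model over the bundle's carriers;
nothing in this file asserts them of any datum except the one-line delivery `paramsPrinted_family` on the KEY consumer's
family carrier.  `AveragingPrinted` pins the one-step averagings to the tree's total extensions of (0.4) ∕ (0.12) (a
gauge-invariant guard with the axial value off the small-field domain, where print's `log` is undefined — the tree's
DIVERGENCE rows T4-D.L ∕ D-pv11g5.1), with print's outer operation `exp[i Σ L^{−d} … (1∕i) log ·]` entering through the
axiomatised `LoopAverage ℰ` (licensed by p. 254 «It is possible to axiomatize them also, listing all essential properties»;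
the literal operation inhabits it on U(N) ∕ SU(N): `ExpMeanLog.expMeanLogU` ∕ `expMeanLogSU`) and the inner average `M` of
(0.11) through `GroupAverage 𝓜` ((0.5)–(0.7); Federbush's (0.10) inhabits it: `BlockAveragingFederbush`,
`B12Average010PureAverage`).  (b) (0.8), analyticity and `Gᶜ`-valued configurations are not expressible over the interface
`GaugeGroup` (no logarithm, no complex structure; DIVERGENCE F4 ∕ F6 of `Setup`) and are therefore not conjuncts of `Hyp`;
the tree's hypothesis structure for them is `B7TransferAnalyticMean.IsAnalyticMean` (cited).  (c) p. 254 «all results of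
the paper [12] are valid for it [(0.12)]» is proved in the tree proposition by proposition for Props. 1–2 and the
properties (11)–(15) of [12] (INDEX, row B12.Eq0.12); the blanket sentence for the remaining propositions of [12] has no
single declaration and is not typed here (typing it faithfully = instantiating `B7.Prop3Printed` … `B7.Prop10Printed` at a
model of (0.12), reader work of the [B7] ∕ [B12] desks, not a carve residual).  (d) p. 256 «In [15] it was proved that …
exactly one critical orbit» is [15] Theorem 1, row B11.Thm1 of BLOCK 11 (`B11.Thm1Printed`, B11's carriers); in `Hyp` the
background fields enter as the datum `bg : Background` (existence of the minimiser on `bg.dom k`, `Setup.IsBackground`),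
exactly as every [B12] module of the tree consumes them; uniqueness modulo the residual gauge group is
`B12GaugeOrbits021.isBackground_iff_of_orbitRel`'s business and B11's theorem, not restated.  (e) The characteristic
functions `χ_k`, the radius `ε₀` and the β-functions are DATA of `Hyp` (`χ`, `S.flow.β`): §0 part 1 names them and defers
their definitions to (0.24) ff., §1 (1.20)–(1.22), §2 (2.2)–(2.3), (2.9) (blocks 18–20).  (f) No `instance`, no `notation`,
0 sorry; imports `…B12`, `…B12Eq019ActionBody`, `…B12Form13Step268`, `…BlockAveragingTwoLevel` only (v1.1 adds `…B12RT013TwoLevel`,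
print's own `T_k` over (0.12), for `averagingPrinted_and_binder_federbush`).  NOT a node discharge,
NOT summit progress; nothing continuum, nothing about the mass gap.
-/

namespace Literature.MathematicalPhysics.QuantumFieldTheory.Balaban1983to89.B12Carve17Sect0ModelHyp

open Literature.MathematicalPhysics.QuantumFieldTheory.Balaban1983to89
open scoped BigOperators

/-! ## §1 The two printed side conditions with no declaration over the bundle's carriers (hypothesis form) -/

/-- **p. 251 [PDF 3]** (text layer `p0003.txt:L22–L23`, `L30`), verbatim: «We take L_μ = L^m, where L is an odd, positive
integer > 11, and m is a positive integer.» … «with a lattice spacing ε = L^{−K}.»; **p. 252 [PDF 4]** (`p0004.txt:L15–L17`):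
«In this paper we are interested mainly in d = 4 gauge field theories. We do all considerations, and write all formulas
below for this case, and only occasionally we discuss some special features of d = 3.»  TYPED over the cell's parameter
record `Setup.Params` (which carries `Odd L ∧ 1 < L` only — DIVERGENCE F1 — and leaves `m`, `d` free; `ε = L^{−K}` IS
`Params.eps` by definition): the dimension is 4, `L > 11`, `m ≥ 1`.  On the KEY consumer's family carrier these are the
FIELDS `T4Continuum.T4Family.hL11`, `T4Continuum.T4Family.hm` and `Missing.params4` (§4 `paramsPrinted_family`); over a bare
`Params` no declaration states them. [cite: Balaban1987RG1, (0.1) p.251 + §0 p.252 («d = 4»)] -/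
def ParamsPrinted (P : Params) : Prop :=
  P.d = 4 ∧ 11 < P.L ∧ 1 ≤ P.m

/-- **pp. 252–254 [PDF 4–6]**, the averaging prescriptions of the renormalization transformations, verbatim: p. 252
«Renormalization transformations are defined by averaging operations. … We define an average of a gauge field
configuration 𝐔, corresponding to a bond c ∈ T⁽¹⁾, by (0.4)»; p. 253 «Having such an average we introduce the averaged
contour variable corresponding to the set of contours 𝐆(y, x), 𝐔(y, x) = M({𝐔(Γ)}_{Γ∈𝐆(y,x)}). (0.11)»; p. 254 «we introduce
the definition (0.12) … Let us stress that both definitions are equally good for our purposes, in fact we may use many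
other definitions. It is possible to axiomatize them also, listing all essential properties» and «We use the variables
U(y, x) defined in (0.11)» (for the gauge fixing (0.14)–(0.17), under either prescription).  TYPED as the PIN of the run's
abstract one-step averagings `av j : Setup.Averaging P j G` and contour data `cd j : Setup.ContourData P j G` to the tree's
constructions WITH BODY: the averaged contour variables (0.11) are `BlockAveragingTwoLevel.contourData 𝓜` for an axiomatic
group average `𝓜` ((0.5)–(0.7), `Setup.GroupAverage`), and the averaging is EITHER (0.4) `BlockAveraging.blockAvg ℰ` OR
(0.12) `BlockAveragingTwoLevel.blockAvg₂ 𝓜 ℰ`, for a small-loop average `ℰ` (`LoopAverage`: print's outer operation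
`exp[i Σ L^{−d} … (1∕i) log ·]`, axiomatised by the tree as print licenses; the literal one on U(N) ∕ SU(N) is
`ExpMeanLog.expMeanLogU` ∕ `expMeanLogSU`).  The SU(N)-data twin with the literal prescriptions is
`T4Continuum.FiniteEpsData.IsPrintedAveraged` (cited, other carrier).  Nothing of (0.4) ∕ (0.11) ∕ (0.12) is restated: the
three bodies are the tree's. [cite: Balaban1987RG1, (0.4) p.253 + (0.11) p.253 + (0.12) p.254] -/
def AveragingPrinted {P : Params} {G : Type*} [GaugeGroup G] (𝓜 : GroupAverage G) (ℰ : LoopAverage G)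
    (av : ∀ j, Averaging P j G) (cd : ∀ j, ContourData P j G) : Prop :=
  (∀ j, cd j = BlockAveragingTwoLevel.contourData 𝓜) ∧
    ((∀ j, av j = BlockAveraging.blockAvg ℰ) ∨ (∀ j, av j = BlockAveragingTwoLevel.blockAvg₂ 𝓜 ℰ))

/-! ## §2 p. 255: the finite-difference and the two differential forms of the renormalization group equation (PROVED) -/

/-- **p. 255 [PDF 7]**, verbatim: «The equation (0.18) written in the form (1∕g₁²) − (1∕g₀²) = (d(1∕g²))₀ = −β₁(g₀) is a finite
difference approximation, corresponding to two consecutive lattice spacings (on a logarithmic scale) of the differential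
equation …» — the rearrangement of the recursive renormalization group equations (0.18)∕(0.20) `Setup.Flow.SatisfiesRG`
at every step `k < K`: `1∕g²_{k+1} − 1∕g_k² = −β_{k+1}(g_k)`.  Kernel-checked algebra. [cite: Balaban1987RG1, (0.18) p.255] -/
theorem diff018_of_satisfiesRG (F : Flow) {K : ℕ} (h : F.SatisfiesRG K) {k : ℕ} (hk : k < K) :
    1 / (F.g (k + 1)) ^ 2 - 1 / (F.g k) ^ 2 = -F.β (k + 1) (F.g k) := by
  have := h k hk
  linarith

/-- **p. 255 [PDF 7]**, verbatim: «… of the differential equation (d∕ds)(1∕g²) = −β(g), or (dg∕ds) = ½β(g)g³. This is the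
usual differential renormalization group equation, an example of a Callan-Symanzik equation, considered in quantum field
theory.» — the printed «or» PROVED: for a coupling `g` differentiable at `s` with `g(s) ≠ 0` and derivative `g′`,
`(d∕ds)(1∕g²) = −β(g)` at `s` if and only if `g′ = ½β(g)g³` at `s` (chain rule `(d∕ds)(1∕g²) = −2g′∕g³` and uniqueness of the
derivative).  Elementary calculus; nothing of the series is used. [cite: Balaban1987RG1, §0 p.255 (after (0.18))] -/
theorem hasDerivAt_invSq_iff {g β : ℝ → ℝ} {s g' : ℝ} (hg : g s ≠ 0) (hd : HasDerivAt g g' s) :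
    HasDerivAt (fun t => 1 / g t ^ 2) (-β (g s)) s ↔ g' = 1 / 2 * β (g s) * g s ^ 3 := by
  have hg2 : g s ^ 2 ≠ 0 := pow_ne_zero 2 hg
  have hg4 : (g s ^ 2) ^ 2 ≠ 0 := pow_ne_zero 2 hg2
  have hp : HasDerivAt (fun t => g t ^ 2) (2 * g s * g') s := by
    simpa using hd.fun_pow 2
  have h2 : HasDerivAt (fun t => 1 / g t ^ 2) (-(2 * g s * g') / (g s ^ 2) ^ 2) s := by
    simpa only [one_div] using hp.fun_inv hg2
  constructor
  · intro h
    have hu : -β (g s) = -(2 * g s * g') / (g s ^ 2) ^ 2 := h.unique h2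
    rw [neg_div, neg_inj, eq_div_iff hg4] at hu
    have h3 : g s * (2 * g') = g s * (β (g s) * g s ^ 3) := by linear_combination (-1 : ℝ) * hu
    have h4 : 2 * g' = β (g s) * g s ^ 3 := mul_left_cancel₀ hg h3
    linear_combination (1 / 2 : ℝ) * h4
  · intro h
    have hval : -β (g s) = -(2 * g s * g') / (g s ^ 2) ^ 2 := by
      rw [neg_div, neg_inj, eq_div_iff hg4, h]
      ring
    rw [hval]
    exact h2

/-! ## §3 The bundle keyed to `stmt-QuantumFields-20541` -/

/-- **BLOCK 17 OF [B12] (pp. 249–256, Sect. 0 part 1) AS ONE HYPOTHESIS**, keyed to `stmt-QuantumFields-20541` (also feeds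
`stmt-QuantumFields-20543`): the conjunction, BY NAME, of the section's printed defining relations in the cell's typed forms,
for ONE lattice approximation with parameters `P` (B12 (0.1)), gauge group `G` (p. 252 «G ⊂ U(N)», the interface
`Setup.GaugeGroup` with its Haar data), one-step averagings `av` with contour data `cd` ((0.4) ∕ (0.11) ∕ (0.12)), renormalization
transformations `T k` ((0.13) with the kernel `δ(ŪV⁻¹)` of (0.17) ∕ (0.19) — the push-forward carrier `Setup.RTOpI` over `av k`),
small-field characteristic functions `χ k` (p. 256 «χ_k restricts the integral to small fluctuation fields»), the sequence of
effective actions and couplings `S` (`S.A k` = A_k, `S.flow.g k` = g_k, `S.flow.β k` = β_k; p. 255 «we assume the existence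
of the first function»), the background fields `bg` ((0.21): `bg.U k V` = U_k(V), minimal on `{U : M^k(U) = V} ∩ reg` for
`V ∈ bg.dom k` — the field `bg.isBackground` is `Setup.IsBackground`; [15] Thm 1 = `B11.Thm1Printed`, block 11) and the functions
`E k` = 𝐄_k, `Ej j` = 𝐄^{(j)} of (0.22) ∕ (0.23) on the finest lattice —
(1) the parameters as printed (p. 251–252) `ParamsPrinted P`;
(2) the averaging prescription (pp. 252–254) `AveragingPrinted 𝓜 ℰ av cd`;
(3) the small-field renormalization steps (0.17) ∕ (0.19) with «𝐍_k is given by the integral above with V = 1», for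
    `k = 0, …, K − 1` (p. 256 «defined for k = 0, 1, …, K»): `Setup.SmallFieldStepI (T k) (χ k) (gaugeFixFn (cd k) univ)
    (g_k) (A_k) (A_{k+1})` — the gauge-fixing double sum `Σ_y Σ_{x∈B(y),x≠y}[1 − Re tr U(y,x)]` is `Setup.gaugeFixFn` over the
    variables (0.11), with `α = g_k²` as in (0.14) ∕ (0.17);
(4) the start of the recursion in (0.17): `A_0 = −(1∕g₀²)A` (the Wilson action (0.2), `d = 4`), `B12Eq019ActionBody.wilsonTerm`;
(5) the recursive renormalization group equations (0.18) ∕ (0.20) `Setup.Flow.SatisfiesRG` for `k < K`;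
(6) the representation (0.22) on the background-field domain, `Setup.EffActionSeq.Representation`;
(7) the sum (0.23) at every `U_k(V)`, `V ∈ bg.dom k`, `B12.Sum023Printed` (with `b j = β_j(g_{j−1})`, `Etot j = 𝐄^{(j)}(U_k)`).
A node prover takes `(h : Hyp …)`; every other display and asserting sentence of pp. 251–256 is a definition WITH BODY or
a PROVED theorem of the tree (INDEX in the module docstring) and is therefore not a hypothesis. [cite: Balaban1987RG1, §0 (0.1)–(0.23) pp.251–256] -/
def Hyp (P : Params) (G : Type*) [GaugeGroup G] [MeasurableSpace G] [HaarData G]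
    (𝓜 : GroupAverage G) (ℰ : LoopAverage G) (av : ∀ j, Averaging P j G) (cd : ∀ j, ContourData P j G)
    (T : ∀ k, RTOpI P k G (av k)) (χ : ∀ k, Density P k G) (S : EffActionSeq P G) (bg : Background P G av)
    (E Ej : ℕ → GaugeField P 0 G → ℝ) : Prop :=
  ParamsPrinted P ∧
  AveragingPrinted 𝓜 ℰ av cd ∧
  (∀ k, k < P.K →
    SmallFieldStepI (T k) (χ k) (gaugeFixFn (cd k) Finset.univ) (S.flow.g k) (S.A k) (S.A (k + 1))) ∧
  S.A 0 = B12Eq019ActionBody.wilsonTerm (S.flow.g 0) 1 ∧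
  S.flow.SatisfiesRG P.K ∧
  S.Representation bg E ∧
  (∀ k (V : GaugeField P k G), V ∈ bg.dom k →
    B12.Sum023Printed (E k (bg.U k V)) (wilsonAction4 (bg.U k V)) (fun j => S.flow.β j (S.flow.g (j - 1)))
      (fun j => Ej j (bg.U k V)) k)

/-! ## §4 Bookkeeping over the bundle (kernel-checked; nothing printed is proved here — every step is a theorem of the tree) -/

section Delivery

variable {P : Params} {G : Type*} [GaugeGroup G] [MeasurableSpace G] [HaarData G]
  {𝓜 : GroupAverage G} {ℰ : LoopAverage G} {av : ∀ j, Averaging P j G} {cd : ∀ j, ContourData P j G}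
  {T : ∀ k, RTOpI P k G (av k)} {χ : ∀ k, Density P k G} {S : EffActionSeq P G} {bg : Background P G av}
  {E Ej : ℕ → GaugeField P 0 G → ℝ}

/-- The bundle IS the seven-fold conjunction (1)–(7) of its docstring, definitionally (unfolding lemma, no content beyond
`Hyp`). [cite: Balaban1987RG1, §0 (0.1)–(0.23) pp.251–256] -/
theorem hyp_iff :
    Hyp P G 𝓜 ℰ av cd T χ S bg E Ej ↔
      ParamsPrinted P ∧
      AveragingPrinted 𝓜 ℰ av cd ∧
      (∀ k, k < P.K →
        SmallFieldStepI (T k) (χ k) (gaugeFixFn (cd k) Finset.univ) (S.flow.g k) (S.A k) (S.A (k + 1))) ∧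
      S.A 0 = B12Eq019ActionBody.wilsonTerm (S.flow.g 0) 1 ∧
      S.flow.SatisfiesRG P.K ∧
      S.Representation bg E ∧
      (∀ k (V : GaugeField P k G), V ∈ bg.dom k →
        B12.Sum023Printed (E k (bg.U k V)) (wilsonAction4 (bg.U k V)) (fun j => S.flow.β j (S.flow.g (j - 1)))
          (fun j => Ej j (bg.U k V)) k) :=
  Iff.rfl

/-- Conjunct (1): the printed parameters (p. 251 «L odd > 11, m positive», p. 252 «d = 4»), `ParamsPrinted`. [cite: Balaban1987RG1, (0.1) p.251] -/
theorem Hyp.params (h : Hyp P G 𝓜 ℰ av cd T χ S bg E Ej) : ParamsPrinted P :=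
  h.1

/-- Conjunct (2): the averaging prescription (0.4) ∕ (0.11) ∕ (0.12) pinned to the tree's bodies, `AveragingPrinted`. [cite: Balaban1987RG1, (0.4) p.253 + (0.12) p.254] -/
theorem Hyp.averaging (h : Hyp P G 𝓜 ℰ av cd T χ S bg E Ej) : AveragingPrinted 𝓜 ℰ av cd :=
  h.2.1

/-- Conjunct (3): the small-field steps (0.17) ∕ (0.19) for `k < K`, `Setup.SmallFieldStepI`. [cite: Balaban1987RG1, (0.19) p.255] -/
theorem Hyp.step019 (h : Hyp P G 𝓜 ℰ av cd T χ S bg E Ej) :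
    ∀ k, k < P.K →
      SmallFieldStepI (T k) (χ k) (gaugeFixFn (cd k) Finset.univ) (S.flow.g k) (S.A k) (S.A (k + 1)) :=
  h.2.2.1

/-- Conjunct (4): the start `A_0 = −(1∕g₀²)A` of (0.17), `B12Eq019ActionBody.wilsonTerm`. [cite: Balaban1987RG1, (0.17) p.255] -/
theorem Hyp.start017 (h : Hyp P G 𝓜 ℰ av cd T χ S bg E Ej) :
    S.A 0 = B12Eq019ActionBody.wilsonTerm (S.flow.g 0) 1 :=
  h.2.2.2.1

/-- Conjunct (5): the recursive renormalization group equations (0.18) ∕ (0.20), `Setup.Flow.SatisfiesRG` (= `Step.RGEq` by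
`Step.rgEq_iff`). [cite: Balaban1987RG1, (0.20) p.256] -/
theorem Hyp.rg020 (h : Hyp P G 𝓜 ℰ av cd T χ S bg E Ej) : S.flow.SatisfiesRG P.K :=
  h.2.2.2.2.1

/-- Conjunct (5) in the raw-sequence form `Step.RGEq` of the cell's `Step` module (definitionally the same proposition,
`Step.rgEq_iff`). [cite: Balaban1987RG1, (0.20) p.256] -/
theorem Hyp.rgEq (h : Hyp P G 𝓜 ℰ av cd T χ S bg E Ej) : Step.RGEq P.K S.flow.β S.flow.g :=
  (Step.rgEq_iff S.flow P.K).mp h.rg020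

/-- Conjunct (6): the representation (0.22), `Setup.EffActionSeq.Representation`. [cite: Balaban1987RG1, (0.22) p.256] -/
theorem Hyp.repr022 (h : Hyp P G 𝓜 ℰ av cd T χ S bg E Ej) : S.Representation bg E :=
  h.2.2.2.2.2.1

/-- Conjunct (7): the sum (0.23) at every background field `U_k(V)`, `B12.Sum023Printed`. [cite: Balaban1987RG1, (0.23) p.256] -/
theorem Hyp.sum023 (h : Hyp P G 𝓜 ℰ av cd T χ S bg E Ej) :
    ∀ k (V : GaugeField P k G), V ∈ bg.dom k →
      B12.Sum023Printed (E k (bg.U k V)) (wilsonAction4 (bg.U k V)) (fun j => S.flow.β j (S.flow.g (j - 1)))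
        (fun j => Ej j (bg.U k V)) k :=
  h.2.2.2.2.2.2

/-- Conjunct (2), first half: the contour variables of the gauge fixing are the averaged contour variables (0.11). [cite: Balaban1987RG1, (0.11) p.253] -/
theorem Hyp.contourData_eq (h : Hyp P G 𝓜 ℰ av cd T χ S bg E Ej) (j : ℕ) :
    cd j = BlockAveragingTwoLevel.contourData 𝓜 :=
  h.averaging.1 j

/-- Conjunct (2), second half: the averaging is (0.4) or (0.12) (p. 254 «both definitions are equally good for our
purposes»). [cite: Balaban1987RG1, (0.12) p.254] -/
theorem Hyp.avg_eq_or (h : Hyp P G 𝓜 ℰ av cd T χ S bg E Ej) :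
    (∀ j, av j = BlockAveraging.blockAvg ℰ) ∨ (∀ j, av j = BlockAveragingTwoLevel.blockAvg₂ 𝓜 ℰ) :=
  h.averaging.2

/-- **p. 255, over the bundle**: the finite-difference form `1∕g²_{k+1} − 1∕g_k² = −β_{k+1}(g_k)` of (0.18) ∕ (0.20) at every step
`k < K` (§2 `diff018_of_satisfiesRG`). [cite: Balaban1987RG1, (0.18) p.255] -/
theorem Hyp.diff018 (h : Hyp P G 𝓜 ℰ av cd T χ S bg E Ej) {k : ℕ} (hk : k < P.K) :
    1 / (S.flow.g (k + 1)) ^ 2 - 1 / (S.flow.g k) ^ 2 = -S.flow.β (k + 1) (S.flow.g k) :=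
  diff018_of_satisfiesRG S.flow h.rg020 hk

/-- **(0.20) telescoped, over the bundle**: `1∕g_m² = 1∕g_n² + Σ_{j∈[m,n)} β_{j+1}(g_j)` for `m ≤ n ≤ K` — the tree's
`Step.inv_sq_telescope` applied to conjunct (5) (the bookkeeping behind p. 256 «the sequence of … coupling constants is
defined for k = 0, 1, …, K»). [cite: Balaban1987RG1, (0.20) p.256] -/
theorem Hyp.invSq_telescope (h : Hyp P G 𝓜 ℰ av cd T χ S bg E Ej) {m n : ℕ} (hmn : m ≤ n) (hn : n ≤ P.K) :
    1 / (S.flow.g m) ^ 2 = 1 / (S.flow.g n) ^ 2 + ∑ j ∈ Finset.Ico m n, S.flow.β (j + 1) (S.flow.g j) :=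
  Step.inv_sq_telescope h.rgEq hmn hn

/-- **«defined inductively», over the bundle** (p. 256 «the sequence of actions and coupling constants is defined for k = 0, 1,
…, K»; Theorem 3 p. 264 «the sequence of actions A_k, defined inductively by the small field renormalization transformations
(0.17)–(0.20)»): conjuncts (3) + (4) force the datum `S.A` to BE the printed inductive sequence with body,
`B12Eq019ActionBody.printedSeq` (`A_0 = −(1∕g₀²)A`, `A_{k+1} = 𝐓_kA_k = log 𝐍_k⁻¹ T_k(χ_k e^{−GF∕g_k² + A_k})`), for all `k ≤ K` —
the tree's `B12Eq019ActionBody.eq_actionSeq_of_steps` (the step predicate `Setup.SmallFieldStepI` is `Setup.SmallFieldStepOp`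
at `(T k).T`, `Setup.smallFieldStepI_eq_op`). [cite: Balaban1987RG1, (0.17)–(0.19) p.255–256] -/
theorem Hyp.effAction_eq_printedSeq (h : Hyp P G 𝓜 ℰ av cd T χ S bg E Ej) :
    ∀ k, k ≤ P.K →
      S.A k = B12Eq019ActionBody.printedSeq (fun k => (T k).T) χ (fun k => gaugeFixFn (cd k) Finset.univ) S.flow.g 1 k := by
  intro k hk
  have hsteps : ∀ k, k < P.K → SmallFieldStepOp ((fun k => (T k).T) k) (χ k)
      ((fun k => (gaugeFixFn (cd k) Finset.univ : Density P k G)) k) (S.flow.g k) (S.A k) (S.A (k + 1)) :=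
    fun k hk => (smallFieldStepI_eq_op (T k) _ _ _ _ _) ▸ h.step019 k hk
  have := B12Eq019ActionBody.eq_actionSeq_of_steps hsteps k hk
  rw [this, B12Eq019ActionBody.printedSeq, h.start017]

/-- **«The meaning of the function 𝐄_k is obvious, it is equal to (1∕g_k²)A + A_k», over the bundle** (the (0.22) reading used
on p. 265; here from conjunct (6) by the tree's `B12Eq019ActionBody.Ek_eq_of_representation`): on the background-field
domain, `𝐄_k(U_k(V)) = (1∕g_k²)A(U_k(V)) + A_k(V)`. [cite: Balaban1987RG1, (0.22) p.256] -/
theorem Hyp.Ek_eq (h : Hyp P G 𝓜 ℰ av cd T χ S bg E Ej) {k : ℕ} {V : GaugeField P k G} (hV : V ∈ bg.dom k) :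
    E k (bg.U k V) = (1 / (S.flow.g k) ^ 2) * wilsonAction4 (bg.U k V) + S.A k V :=
  B12Eq019ActionBody.Ek_eq_of_representation h.repr022 hV

/-- **The parameters clause on the KEY consumer's carrier**: every four-torus family `F : T4Continuum.T4Family` (whose fields
ARE print's «L odd > 11», «m positive», and whose `F.P K` has `d = 4` by `Missing.params4`) satisfies `ParamsPrinted (F.P K)`
at every `K`. [cite: Balaban1987RG1, (0.1) p.251] -/
theorem paramsPrinted_family (F : T4Continuum.T4Family) (K : ℕ) : ParamsPrinted (F.P K) :=
  ⟨rfl, F.hL11, F.hm⟩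

end Delivery

section Tower

variable {P : Params} {G : Type*} [GaugeGroup G] {Φ 𝒢 : Type*}

/-- **Conjunct (7) is discharged by the tower body** (p. 256: «In the second step a new expression of this type is created,
in the old only a background field is changed. Thus we obtain after k steps (0.23)»): if 𝐄_k and 𝐄^{(j)} are READ OFF a
small-field tower `Tw : Step.SFTower` of the cell (`E k = Tw.Ek k`, the body (0.23) in the (1.6) reading, and `Ej j` = the
vacuum-subtracted `j`-th term `𝐄^{(j)}(g_{j−1}, ·) − 𝐄^{(j)}(g_{j−1}, 1)`, p. 258 normalization `𝐄^{(j)}(1) = 0`), then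
`B12.Sum023Printed` holds at EVERY configuration — the tree's `B12Form13Step268.sum023Printed_Ek`; so a prover supplying
`Hyp` from a tower owes conjuncts (1)–(6) only. [cite: Balaban1987RG1, (0.23) p.256] -/
theorem sum023_of_tower (Tw : Step.SFTower P G Φ 𝒢) (k : ℕ) (U : GaugeField P 0 G) :
    B12.Sum023Printed (Tw.Ek k U) (wilsonAction4 U) (fun j => Tw.flow.β j (Tw.flow.g (j - 1)))
      (fun j => (Tw.Etot j (Tw.flow.g (j - 1)) (Tw.ofBackground U)).re
        - (Tw.Etot j (Tw.flow.g (j - 1)) (Tw.ofBackground 1)).re) k :=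
  B12Form13Step268.sum023Printed_Ek Tw k U

/-- The same at the background fields of a run: with `S.flow = Tw.flow`, `E k := Tw.Ek k` and `Ej` the vacuum-subtracted
tower terms, conjunct (7) of `Hyp` holds (for every `bg`). [cite: Balaban1987RG1, (0.23) p.256] -/
theorem sum023_conjunct_of_tower [MeasurableSpace G] [HaarData G] {av : ∀ j, Averaging P j G}
    (Tw : Step.SFTower P G Φ 𝒢) (S : EffActionSeq P G) (hflow : S.flow = Tw.flow) (bg : Background P G av) :
    ∀ k (V : GaugeField P k G), V ∈ bg.dom k →
      B12.Sum023Printed (Tw.Ek k (bg.U k V)) (wilsonAction4 (bg.U k V)) (fun j => S.flow.β j (S.flow.g (j - 1)))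
        (fun j => (Tw.Etot j (Tw.flow.g (j - 1)) (Tw.ofBackground (bg.U k V))).re
          - (Tw.Etot j (Tw.flow.g (j - 1)) (Tw.ofBackground 1)).re) k := by
  intro k V _
  rw [hflow]
  exact sum023_of_tower Tw k (bg.U k V)

end Tower

/-! ## §5 v1.1 — the bundle of record `HypK`: the renormalization transformations bound on print's range `k = 0, …, K − 1`
(check-2 g4 SECOND-READ RULING M-c2-1 on p612091, `carve/CHECK-2.md` § Verdicts 2026-08-28T10:42:11Z; append-only:
`Hyp`, `hyp_iff` and §§1–4 above are unchanged) -/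

section RangeBound

variable {P : Params} {G : Type*} [GaugeGroup G] [MeasurableSpace G] [HaarData G]

/-- The total operator family read off a range-bound family of renormalization transformations `T k hk` (`k < K`): the
operator `(T k hk).T` of (0.13) in print's range, and the zero operator beyond it (a placeholder never touched by the
small-field steps, which run for `k < K` only) — so that the tree's total-family bookkeeping
(`B12Eq019ActionBody.printedSeq`, `eq_actionSeq_of_steps`) applies to `HypK` verbatim. [cite: Balaban1987RG1, (0.13) p.254 + (0.19) p.255–256 («k = 0,1,...,K»)] -/
def opOfRange {av : ∀ j, Averaging P j G} (T : ∀ k, k < P.K → RTOpI P k G (av k)) (k : ℕ) :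
    Density P k G → Density P (k + 1) G :=
  if hk : k < P.K then (T k hk).T else fun _ => 0

/-- In print's range the total family IS the given transformation's operator. [cite: Balaban1987RG1, (0.13) p.254] -/
theorem opOfRange_of_lt {av : ∀ j, Averaging P j G} (T : ∀ k, k < P.K → RTOpI P k G (av k)) {k : ℕ} (hk : k < P.K) :
    opOfRange T k = (T k hk).T :=
  dif_pos hk

/-- Beyond print's range the total family is the zero placeholder. [cite: Balaban1987RG1, (0.19) p.256 («k = 0,1,...,K»)] -/
theorem opOfRange_of_not_lt {av : ∀ j, Averaging P j G} (T : ∀ k, k < P.K → RTOpI P k G (av k)) {k : ℕ}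
    (hk : ¬ k < P.K) : opOfRange T k = fun _ => 0 :=
  dif_neg hk

/-- **BLOCK 17 OF [B12] (pp. 249–256, Sect. 0 part 1) AS ONE HYPOTHESIS — v1.1, THE BUNDLE OF RECORD** keyed to
`stmt-QuantumFields-20541` (also feeds `stmt-QuantumFields-20543`): the same seven printed conjuncts (1)–(7) as `Hyp` (§3),
over the same carriers, with ONE change of binder — the renormalization transformations are the data
`T k hk : Setup.RTOpI P k G (av k)` for `k < K` ONLY.  **p. 256 [PDF 8]** (text layer `p0008.txt:L7–L10`), verbatim: «We
continue the calculation of the effective actions until we reach the unit lattice … Let us denote the corresponding index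
by K, hence ε = L^{−K}, and the sequence of actions and coupling constants is defined for k = 0,1,...,K.» — the
transformations T^{(k)} of (0.17) ∕ (0.19) (p. 255) act for `k = 0, …, K − 1`, between the lattices `T^{(k)} → T^{(k+1)}` of
(0.1) (p. 251), and print forms no transformation beyond.  WHY v1.1 (check-2 g4 SECOND-READ RULING M-c2-1,
`carve/CHECK-2.md` 2026-08-28T10:42:11Z; no printed clause of v1 was mis-transcribed): `Hyp` binds
`T : ∀ k, RTOpI P k G (av k)` at EVERY `k : ℕ` while conjunct (2) pins `av k` to print's map (0.4) ∕ (0.12) at every `k`;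
an `RTOpI` over an averaging exists only under Haar absolute continuity of its map (`T4FiniteEpsInhabited.rtOpIOfAC`;
conversely `B10Eq2HaarCompatibility.haarAC_of_rtOpI`), which the tree proves for (0.4) ∕ (0.12) in the standing range
`k + 1 ≤ m + K` only (`BlockAveragingEMLFibreLawSUN.haarAC_avgFun₂_expMeanLogSU_SUN`) — its own level families SWITCH the
averaging beyond that range for this reason (`B12RT013TwoLevel.blockAvg₂Std` ∕ `rtOpITwoLevelStd`,
`B10Eq2DensityTower.blockAvgStd`) — so the pair (binder `T`, conjunct (2)) of `Hyp` has no constructible instance at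
print's groups (`G ⊂ U(N)` semisimple, p. 252), only at the trivial group.  With the range-bound binder the pair IS
instantiated in the tree at `SU(N)`, every `N ≥ 1`, every `P`, with BOTH printed operations — Federbush's inner mean (0.10)
and the exp-mean-log outer average of (0.12): `B12RT013TwoLevel.rtOpITwoLevelFederbush`, kernel-checked below as
`averagingPrinted_and_binder_federbush`.  CONJUNCTS: (1) the parameters as printed (pp. 251–252) `ParamsPrinted P`; (2) the
averaging prescription (pp. 252–254) `AveragingPrinted 𝓜 ℰ av cd`; (3) for every `k < K`, the small-field renormalization
step (0.17) ∕ (0.19) with «𝐍_k is given by the integral above with V = 1»: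
`Setup.SmallFieldStepI (T k hk) (χ k) (gaugeFixFn (cd k) univ) (g_k) (A_k) (A_{k+1})` (gauge fixing `Setup.gaugeFixFn` over
the variables (0.11), `α = g_k²` as in (0.14) ∕ (0.17)) — print's (0.19) DEFINES `A_{k+1}(g_{k+1}, V) = log 𝐍_k⁻¹ ∫dU Π_c
δ(Ū(c)V⁻¹(c)) χ_k exp[…]` at every `V`, so positivity of the transform everywhere is print's own content; `T k hk` and `χ k`
are FREE data and the version of the operator (a Radon–Nikodym transport in every in-tree instance) is the instantiator's
to choose (check-2 N-c2-44, zero weight); (4) the start of the recursion in (0.17), `A_0 = −(1∕g₀²)A`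
(`B12Eq019ActionBody.wilsonTerm`, `d = 4`); (5) the recursive renormalization group equations (0.18) ∕ (0.20)
`Setup.Flow.SatisfiesRG` for `k < K`; (6) the representation (0.22) on the background-field domain,
`Setup.EffActionSeq.Representation`; (7) the sum (0.23) at every `U_k(V)`, `V ∈ bg.dom k`, `B12.Sum023Printed`.  A node
prover takes `(h : HypK …)`; `Hyp` implies `HypK` (`hypK_of_hyp`); every other display and asserting sentence of
pp. 251–256 is a definition WITH BODY or a PROVED theorem of the tree (INDEX in the module docstring).
[cite: Balaban1987RG1, §0 (0.1)–(0.23) pp.251–256 + p.256 «defined for k = 0,1,...,K»] -/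
def HypK (P : Params) (G : Type*) [GaugeGroup G] [MeasurableSpace G] [HaarData G]
    (𝓜 : GroupAverage G) (ℰ : LoopAverage G) (av : ∀ j, Averaging P j G) (cd : ∀ j, ContourData P j G)
    (T : ∀ k, k < P.K → RTOpI P k G (av k)) (χ : ∀ k, Density P k G) (S : EffActionSeq P G) (bg : Background P G av)
    (E Ej : ℕ → GaugeField P 0 G → ℝ) : Prop :=
  ParamsPrinted P ∧
  AveragingPrinted 𝓜 ℰ av cd ∧
  (∀ k (hk : k < P.K),
    SmallFieldStepI (T k hk) (χ k) (gaugeFixFn (cd k) Finset.univ) (S.flow.g k) (S.A k) (S.A (k + 1))) ∧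
  S.A 0 = B12Eq019ActionBody.wilsonTerm (S.flow.g 0) 1 ∧
  S.flow.SatisfiesRG P.K ∧
  S.Representation bg E ∧
  (∀ k (V : GaugeField P k G), V ∈ bg.dom k →
    B12.Sum023Printed (E k (bg.U k V)) (wilsonAction4 (bg.U k V)) (fun j => S.flow.β j (S.flow.g (j - 1)))
      (fun j => Ej j (bg.U k V)) k)

variable {𝓜 : GroupAverage G} {ℰ : LoopAverage G} {av : ∀ j, Averaging P j G} {cd : ∀ j, ContourData P j G}
  {T : ∀ k, k < P.K → RTOpI P k G (av k)} {χ : ∀ k, Density P k G} {S : EffActionSeq P G} {bg : Background P G av}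
  {E Ej : ℕ → GaugeField P 0 G → ℝ}

/-- `HypK` IS the seven-fold conjunction (1)–(7) of its docstring, definitionally (unfolding lemma, no content beyond
`HypK`). [cite: Balaban1987RG1, §0 (0.1)–(0.23) pp.251–256] -/
theorem hypK_iff :
    HypK P G 𝓜 ℰ av cd T χ S bg E Ej ↔
      ParamsPrinted P ∧
      AveragingPrinted 𝓜 ℰ av cd ∧
      (∀ k (hk : k < P.K),
        SmallFieldStepI (T k hk) (χ k) (gaugeFixFn (cd k) Finset.univ) (S.flow.g k) (S.A k) (S.A (k + 1))) ∧
      S.A 0 = B12Eq019ActionBody.wilsonTerm (S.flow.g 0) 1 ∧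
      S.flow.SatisfiesRG P.K ∧
      S.Representation bg E ∧
      (∀ k (V : GaugeField P k G), V ∈ bg.dom k →
        B12.Sum023Printed (E k (bg.U k V)) (wilsonAction4 (bg.U k V)) (fun j => S.flow.β j (S.flow.g (j - 1)))
          (fun j => Ej j (bg.U k V)) k) :=
  Iff.rfl

/-- **v1 implies v1.1**: a witness of `Hyp` (transformations at every level) restricts to a witness of `HypK` (the same
transformations on print's range `k < K`); conjuncts (1), (2), (4)–(7) are carried over verbatim. [cite: Balaban1987RG1, (0.19) p.255–256 («k = 0,1,...,K»)] -/
theorem hypK_of_hyp {Tall : ∀ k, RTOpI P k G (av k)} (h : Hyp P G 𝓜 ℰ av cd Tall χ S bg E Ej) :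
    HypK P G 𝓜 ℰ av cd (fun k _ => Tall k) χ S bg E Ej :=
  ⟨h.1, h.2.1, fun k hk => h.2.2.1 k hk, h.2.2.2.1, h.2.2.2.2.1, h.2.2.2.2.2.1, h.2.2.2.2.2.2⟩

/-- Conjunct (1) of `HypK`: the printed parameters (p. 251 «L odd > 11, m positive», p. 252 «d = 4»), `ParamsPrinted`. [cite: Balaban1987RG1, (0.1) p.251] -/
theorem HypK.params (h : HypK P G 𝓜 ℰ av cd T χ S bg E Ej) : ParamsPrinted P :=
  h.1

/-- Conjunct (2) of `HypK`: the averaging prescription (0.4) ∕ (0.11) ∕ (0.12) pinned to the tree's bodies, `AveragingPrinted`. [cite: Balaban1987RG1, (0.4) p.253 + (0.12) p.254] -/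
theorem HypK.averaging (h : HypK P G 𝓜 ℰ av cd T χ S bg E Ej) : AveragingPrinted 𝓜 ℰ av cd :=
  h.2.1

/-- Conjunct (3) of `HypK`: the small-field steps (0.17) ∕ (0.19) for `k < K`, `Setup.SmallFieldStepI` at the range-bound
transformation `T k hk`. [cite: Balaban1987RG1, (0.19) p.255] -/
theorem HypK.step019 (h : HypK P G 𝓜 ℰ av cd T χ S bg E Ej) :
    ∀ k (hk : k < P.K),
      SmallFieldStepI (T k hk) (χ k) (gaugeFixFn (cd k) Finset.univ) (S.flow.g k) (S.A k) (S.A (k + 1)) :=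
  h.2.2.1

/-- Conjunct (3) of `HypK` in the operator form `Setup.SmallFieldStepOp` over the total family `opOfRange T` (the form the
tree's sequence bookkeeping consumes). [cite: Balaban1987RG1, (0.19) p.255] -/
theorem HypK.stepOp019 (h : HypK P G 𝓜 ℰ av cd T χ S bg E Ej) :
    ∀ k, k < P.K →
      SmallFieldStepOp (opOfRange T k) (χ k) (gaugeFixFn (cd k) Finset.univ) (S.flow.g k) (S.A k) (S.A (k + 1)) := by
  intro k hk
  rw [opOfRange_of_lt T hk]
  exact (smallFieldStepI_eq_op (T k hk) _ _ _ _ _) ▸ h.step019 k hk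

/-- Conjunct (4) of `HypK`: the start `A_0 = −(1∕g₀²)A` of (0.17), `B12Eq019ActionBody.wilsonTerm`. [cite: Balaban1987RG1, (0.17) p.255] -/
theorem HypK.start017 (h : HypK P G 𝓜 ℰ av cd T χ S bg E Ej) :
    S.A 0 = B12Eq019ActionBody.wilsonTerm (S.flow.g 0) 1 :=
  h.2.2.2.1

/-- Conjunct (5) of `HypK`: the recursive renormalization group equations (0.18) ∕ (0.20), `Setup.Flow.SatisfiesRG`. [cite: Balaban1987RG1, (0.20) p.256] -/
theorem HypK.rg020 (h : HypK P G 𝓜 ℰ av cd T χ S bg E Ej) : S.flow.SatisfiesRG P.K :=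
  h.2.2.2.2.1

/-- Conjunct (5) of `HypK` in the raw-sequence form `Step.RGEq` (definitionally the same proposition, `Step.rgEq_iff`). [cite: Balaban1987RG1, (0.20) p.256] -/
theorem HypK.rgEq (h : HypK P G 𝓜 ℰ av cd T χ S bg E Ej) : Step.RGEq P.K S.flow.β S.flow.g :=
  (Step.rgEq_iff S.flow P.K).mp h.rg020

/-- Conjunct (6) of `HypK`: the representation (0.22), `Setup.EffActionSeq.Representation`. [cite: Balaban1987RG1, (0.22) p.256] -/
theorem HypK.repr022 (h : HypK P G 𝓜 ℰ av cd T χ S bg E Ej) : S.Representation bg E :=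
  h.2.2.2.2.2.1

/-- Conjunct (7) of `HypK`: the sum (0.23) at every background field `U_k(V)`, `B12.Sum023Printed`. [cite: Balaban1987RG1, (0.23) p.256] -/
theorem HypK.sum023 (h : HypK P G 𝓜 ℰ av cd T χ S bg E Ej) :
    ∀ k (V : GaugeField P k G), V ∈ bg.dom k →
      B12.Sum023Printed (E k (bg.U k V)) (wilsonAction4 (bg.U k V)) (fun j => S.flow.β j (S.flow.g (j - 1)))
        (fun j => Ej j (bg.U k V)) k :=
  h.2.2.2.2.2.2

/-- Conjunct (2) of `HypK`, first half: the contour variables of the gauge fixing are the averaged contour variables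
(0.11). [cite: Balaban1987RG1, (0.11) p.253] -/
theorem HypK.contourData_eq (h : HypK P G 𝓜 ℰ av cd T χ S bg E Ej) (j : ℕ) :
    cd j = BlockAveragingTwoLevel.contourData 𝓜 :=
  h.averaging.1 j

/-- Conjunct (2) of `HypK`, second half: the averaging is (0.4) or (0.12) (p. 254 «both definitions are equally good for
our purposes»). [cite: Balaban1987RG1, (0.12) p.254] -/
theorem HypK.avg_eq_or (h : HypK P G 𝓜 ℰ av cd T χ S bg E Ej) :
    (∀ j, av j = BlockAveraging.blockAvg ℰ) ∨ (∀ j, av j = BlockAveragingTwoLevel.blockAvg₂ 𝓜 ℰ) :=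
  h.averaging.2

/-- **p. 255, over `HypK`**: the finite-difference form `1∕g²_{k+1} − 1∕g_k² = −β_{k+1}(g_k)` of (0.18) ∕ (0.20) at every
step `k < K` (§2 `diff018_of_satisfiesRG`). [cite: Balaban1987RG1, (0.18) p.255] -/
theorem HypK.diff018 (h : HypK P G 𝓜 ℰ av cd T χ S bg E Ej) {k : ℕ} (hk : k < P.K) :
    1 / (S.flow.g (k + 1)) ^ 2 - 1 / (S.flow.g k) ^ 2 = -S.flow.β (k + 1) (S.flow.g k) :=
  diff018_of_satisfiesRG S.flow h.rg020 hk

/-- **(0.20) telescoped, over `HypK`**: `1∕g_m² = 1∕g_n² + Σ_{j∈[m,n)} β_{j+1}(g_j)` for `m ≤ n ≤ K` (the tree's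
`Step.inv_sq_telescope` on conjunct (5)). [cite: Balaban1987RG1, (0.20) p.256] -/
theorem HypK.invSq_telescope (h : HypK P G 𝓜 ℰ av cd T χ S bg E Ej) {m n : ℕ} (hmn : m ≤ n) (hn : n ≤ P.K) :
    1 / (S.flow.g m) ^ 2 = 1 / (S.flow.g n) ^ 2 + ∑ j ∈ Finset.Ico m n, S.flow.β (j + 1) (S.flow.g j) :=
  Step.inv_sq_telescope h.rgEq hmn hn

/-- **«defined inductively», over `HypK`** (p. 256 «the sequence of actions and coupling constants is defined for
k = 0, 1, …, K»): conjuncts (3) + (4) force the datum `S.A` to BE the printed inductive sequence with body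
`B12Eq019ActionBody.printedSeq` over the total family `opOfRange T` (`A_0 = −(1∕g₀²)A`, `A_{k+1} = 𝐓_kA_k`), for all
`k ≤ K` — the tree's `B12Eq019ActionBody.eq_actionSeq_of_steps`. [cite: Balaban1987RG1, (0.17)–(0.19) p.255–256] -/
theorem HypK.effAction_eq_printedSeq (h : HypK P G 𝓜 ℰ av cd T χ S bg E Ej) :
    ∀ k, k ≤ P.K →
      S.A k = B12Eq019ActionBody.printedSeq (opOfRange T) χ (fun k => gaugeFixFn (cd k) Finset.univ) S.flow.g 1 k := by
  intro k hk
  have := B12Eq019ActionBody.eq_actionSeq_of_steps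
    (Tk := opOfRange T) (χ := χ) (GF := fun k => (gaugeFixFn (cd k) Finset.univ : Density P k G)) (g := S.flow.g)
    h.stepOp019 k hk
  rw [this, B12Eq019ActionBody.printedSeq, h.start017]

/-- **«𝐄_k … is equal to (1∕g_k²)A + A_k», over `HypK`** (the (0.22) reading used on p. 265; from conjunct (6) by the tree's
`B12Eq019ActionBody.Ek_eq_of_representation`). [cite: Balaban1987RG1, (0.22) p.256] -/
theorem HypK.Ek_eq (h : HypK P G 𝓜 ℰ av cd T χ S bg E Ej) {k : ℕ} {V : GaugeField P k G} (hV : V ∈ bg.dom k) :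
    E k (bg.U k V) = (1 / (S.flow.g k) ^ 2) * wilsonAction4 (bg.U k V) + S.A k V :=
  B12Eq019ActionBody.Ek_eq_of_representation h.repr022 hV

end RangeBound

section BinderInhabited

/-- **The repaired pair (conjunct (2), binder `T`) is instantiated in the tree at print's groups**: on `SU(N)`, every
`N ≥ 1`, every parameter record `P`, with BOTH printed operations — the averaged contour variables (0.11) and the two-level
averaging (0.12) built on Federbush's inner mean (0.10) (`FederbushMean.federbushSU`) and the exp-mean-log outer average
(`ExpMeanLog.expMeanLogSU`) — conjunct (2) `AveragingPrinted` holds by `rfl`, AND the range-bound binder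
`∀ k, k < K → RTOpI P k SU(N) (blockAvg₂ …)` of `HypK` is inhabited by print's own renormalization transformation
`B12RT013TwoLevel.rtOpITwoLevelFederbush` (hypothesis-free in the standing range `k + 1 ≤ m + K ⊇ {k < K}`).  This is the
instantiability that `Hyp`'s all-level binder lacks (check-2 g4 M-c2-1). [cite: Balaban1987RG1, (0.10)–(0.13) pp.253–254 + (0.19) p.255–256] -/
theorem averagingPrinted_and_binder_federbush (N : ℕ) [NeZero N] (P : Params) :
    AveragingPrinted (P := P) (FederbushMean.federbushSU (n := Fin N)) ExpMeanLog.expMeanLogSU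
        (fun _ => BlockAveragingTwoLevel.blockAvg₂ (FederbushMean.federbushSU (n := Fin N)) ExpMeanLog.expMeanLogSU)
        (fun _ => BlockAveragingTwoLevel.contourData (FederbushMean.federbushSU (n := Fin N))) ∧
      Nonempty (∀ k, k < P.K → RTOpI P k (Matrix.specialUnitaryGroup (Fin N) ℂ)
        (BlockAveragingTwoLevel.blockAvg₂ (FederbushMean.federbushSU (n := Fin N)) ExpMeanLog.expMeanLogSU)) :=
  ⟨⟨fun _ => rfl, Or.inr fun _ => rfl⟩, ⟨fun _ hk => B12RT013TwoLevel.rtOpITwoLevelFederbush (by omega)⟩⟩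

end BinderInhabited


end Literature.MathematicalPhysics.QuantumFieldTheory.Balaban1983to89.B12Carve17Sect0ModelHyp
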